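import Summits.Ventures.CertifiedArithmetic.LowPrec.AccumulateDirected
import Summits.Ventures.CertifiedArithmetic.LowPrec.ErrorFreeAdd

/-!
# Error-free transformation of addition under TRUNCATION (roundTowardZero): same sign yes, else no

HONEST FRAMING (venture CertifiedArithmetic / cell `pub-lowprec`): certified error envelopes and
provably optimal rounding/accumulation schemes for low-precision formats under stated cost models;
every table by two implementations; no hardware or vendor claims.

Under round-to-nearest the error of a floating-point addition is always a value of the format and
Fast2Sum recovers it (`ErrorFreeAdd.lean`, every format, saturation included). Under DIRECTED
rounding this fails in general — the cell's GEMM note records "ρ = RZ: kahan/kbn — no bound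
instantiated (Fast2Sum is not error-free under directed rounding; Graillat–Jézéquel 2020)". This
file makes the boundary precise for the venture's truncation `roundTowardZero φ` (every format,
saturation at `±maxRat` included, no range hypothesis):
* SAME SIGN ⇒ EFT: for values `a, b ≥ 0` (or both `≤ 0`) the truncation error
  `a + b - RZ(a + b)` IS a value of `φ` (`MiniFloat.rz_addErr_representable_of_nonneg`): it is a
  nonnegative multiple of the smaller operand's ulp not exceeding that operand (the same EFT
  criterion as in the nearest case, `representable_natAbs_of_dvd_le`); and FAST2SUM WITH TRUNCATED
  OPERATIONS returns it exactly when `|b| ≤ |a|` (`MiniFloat.fast2Sum_rz_exact_of_nonneg`): so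
  compensated truncated accumulation of SAME-SIGN data (e.g. products of nonnegative factors) does
  have exact local corrections;
* MIXED SIGNS ⇒ NOT an EFT (kernel counterexample, `E5M2`): `a = 1`, `b = -2^-9`:
  `RZ(a + b) = 7/8`, error `63/512` needs six significand bits — not an `E5M2` value; truncated
  Fast2Sum returns `7/64 ≠ 63/512` (`rz_addErr_not_representable_E5M2`);
* ROUND-UP, same sign ⇒ NOT an EFT either (`E5M2`: `a = 1`, `b = 2^-9`, `RU = 5/4`, error
  `127/512 ∉ F`): among the directed modes it is truncation of same-sign sums that keeps the EFT.
Placement: the nearest-case EFT is classical (Dekker 1971, Knuth; Boldo–Melquiond 2017 §5.1);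
for directed roundings the representability of the addition error "is not always true"
[MullerEtAl2018, §4.3.3]; the same-sign truncation statement is elementary and presumably
folklore — recorded here because the cell's RZ accumulation rows use exactly this mode.
-/

namespace Literature.ComputerArithmetic.FloatingPoint

namespace MiniFloat

open Format

variable {φ : Format}

/-! ### Truncation of a nonnegative sum of values -/

/-- For `x ≥ 0`, the truncation has the value `rdGrid(x / quantum) · quantum`. [folklore] -/
theorem toRat_roundTowardZero_of_nonneg {x : ℚ} (hx : 0 ≤ x) :
    (roundTowardZero φ x).toRat = (φ.rdGrid (x / φ.quantum) : ℚ) * φ.quantum := by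
  rw [toRat_roundTowardZero, if_neg (not_lt.mpr hx), abs_of_nonneg hx]

/-- A value `y ≥ 0` below `x` stays below the truncation: `y ≤ RZ(x)` (optimality of round-down,
no range hypothesis — beyond `maxRat` the truncation is `maxRat ≥ y`). [cite: IEEE7542019, §4.3.2] -/
theorem toRat_le_roundTowardZero_of_le {x : ℚ} (y : MiniFloat φ) (hy0 : 0 ≤ y.toRat)
    (hyx : y.toRat ≤ x) : y.toRat ≤ (roundTowardZero φ x).toRat := by
  have hq := φ.quantum_pos
  have hx : 0 ≤ x := le_trans hy0 hyx
  rw [toRat_roundTowardZero_of_nonneg hx]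
  have hyv : y.toRat = (y.scaledMag : ℚ) * φ.quantum := by
    rw [← abs_of_nonneg hy0, abs_toRat]
  have h1 : (y.scaledMag : ℚ) ≤ x / φ.quantum := by
    rw [le_div_iff₀ hq, ← hyv]; exact hyx
  have h2 := Format.le_rdGrid_of_le (div_nonneg hx hq.le) y.representable_scaledMag h1
  rw [hyv]
  exact mul_le_mul_of_nonneg_right (by exact_mod_cast h2) hq.le

/-- The truncation of `x ≥ 0` is nonnegative. [folklore] -/
theorem toRat_roundTowardZero_nonneg {x : ℚ} (hx : 0 ≤ x) : 0 ≤ (roundTowardZero φ x).toRat := by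
  rw [toRat_roundTowardZero_of_nonneg hx]
  exact mul_nonneg (Nat.cast_nonneg _) φ.quantum_pos.le

/-- The truncation of `x ≥ 0` does not exceed `x`. [folklore] -/
theorem toRat_roundTowardZero_le_of_nonneg {x : ℚ} (hx : 0 ≤ x) :
    (roundTowardZero φ x).toRat ≤ x := by
  have := abs_toRat_roundTowardZero_le (α := φ) x
  rwa [abs_of_nonneg (toRat_roundTowardZero_nonneg hx), abs_of_nonneg hx] at this

/-- SAME-SIGN TRUNCATED ADDITION IS AN EFT (ordered form): for values `0 ≤ b`, `0 ≤ a` with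
`|b| ≤ |a|`, both `RZ(a + b) - a` and `a + b - RZ(a + b)` are values of `φ` — every format, no
range hypothesis (beyond `maxRat` the truncation saturates at `maxRat ≥ a` and the same divisibility
argument applies). [folklore] -/
theorem rz_add_eft_of_nonneg (a b : MiniFloat φ) (ha : 0 ≤ a.toRat) (hb : 0 ≤ b.toRat)
    (hba : b.scaledMag ≤ a.scaledMag) :
    (∃ z : MiniFloat φ, z.toRat = (roundTowardZero φ (a.toRat + b.toRat)).toRat - a.toRat) ∧
    (∃ e : MiniFloat φ, e.toRat = a.toRat + b.toRat - (roundTowardZero φ (a.toRat + b.toRat)).toRat) := by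
  have hq := φ.quantum_pos
  set t := roundTowardZero φ (a.toRat + b.toRat) with ht
  have hs0 : 0 ≤ a.toRat + b.toRat := add_nonneg ha hb
  have hta : a.toRat ≤ t.toRat := toRat_le_roundTowardZero_of_le a ha (by linarith)
  have htb : b.toRat ≤ t.toRat := toRat_le_roundTowardZero_of_le b hb (by linarith)
  have hts : t.toRat ≤ a.toRat + b.toRat := toRat_roundTowardZero_le_of_nonneg hs0
  have ht0 : 0 ≤ t.toRat := le_trans ha hta
  -- ulp(b) divides the signed magnitudes of a, b, t
  have hbt : b.scaledMag ≤ t.scaledMag :=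
    scaledMag_le_of_abs_le (by rw [abs_of_nonneg hb, abs_of_nonneg ht0]; exact htb)
  have da : ((2 ^ (b.expCode - 1) : ℕ) : ℤ) ∣ a.toInt := pow_ulpExp_dvd_toInt hba
  have db : ((2 ^ (b.expCode - 1) : ℕ) : ℤ) ∣ b.toInt := pow_ulpExp_dvd_toInt le_rfl
  have dt : ((2 ^ (b.expCode - 1) : ℕ) : ℤ) ∣ t.toInt := pow_ulpExp_dvd_toInt hbt
  have hbv : b.toRat = (b.scaledMag : ℚ) * φ.quantum := by rw [← abs_of_nonneg hb, abs_toRat]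
  constructor
  · -- z = t - a = (T - A) q, |T - A| ≤ B
    have hrep : φ.Representable (t.toInt - a.toInt).natAbs := by
      refine representable_natAbs_of_dvd_le b (dvd_sub dt da) ?_
      have h1 : (((t.toInt - a.toInt : ℤ) : ℚ)) * φ.quantum = t.toRat - a.toRat := by
        rw [toRat_eq_toInt_mul, toRat_eq_toInt_mul]; push_cast; ring
      have h2 : |(((t.toInt - a.toInt : ℤ) : ℚ))| * φ.quantum ≤ (b.scaledMag : ℚ) * φ.quantum := by
        rw [← abs_of_pos hq, ← abs_mul, abs_of_pos hq, h1, ← hbv, abs_of_nonneg (by linarith)]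
        linarith
      have h3 : |(((t.toInt - a.toInt : ℤ) : ℚ))| ≤ (b.scaledMag : ℚ) := le_of_mul_le_mul_right h2 hq
      rw [← Int.cast_abs] at h3
      have h4 : |t.toInt - a.toInt| ≤ (b.scaledMag : ℤ) := by exact_mod_cast h3
      have h5 : (((t.toInt - a.toInt).natAbs : ℕ) : ℤ) ≤ (b.scaledMag : ℤ) := by
        rw [Int.natCast_natAbs]; exact h4
      exact_mod_cast h5
    obtain ⟨z, hz⟩ := exists_toRat_eq_intCast_mul _ hrep
    exact ⟨z, by rw [hz, toRat_eq_toInt_mul t, toRat_eq_toInt_mul a]; push_cast; ring⟩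
  · -- e = a + b - t = (A + B - T) q, 0 ≤ e ≤ b
    have hrep : φ.Representable (a.toInt + b.toInt - t.toInt).natAbs := by
      refine representable_natAbs_of_dvd_le b (dvd_sub (dvd_add da db) dt) ?_
      have h1 : (((a.toInt + b.toInt - t.toInt : ℤ) : ℚ)) * φ.quantum
          = a.toRat + b.toRat - t.toRat := by
        rw [toRat_eq_toInt_mul, toRat_eq_toInt_mul, toRat_eq_toInt_mul]; push_cast; ring
      have h2 : |(((a.toInt + b.toInt - t.toInt : ℤ) : ℚ))| * φ.quantum
          ≤ (b.scaledMag : ℚ) * φ.quantum := by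
        rw [← abs_of_pos hq, ← abs_mul, abs_of_pos hq, h1, ← hbv, abs_of_nonneg (by linarith)]
        linarith
      have h3 : |(((a.toInt + b.toInt - t.toInt : ℤ) : ℚ))| ≤ (b.scaledMag : ℚ) :=
        le_of_mul_le_mul_right h2 hq
      rw [← Int.cast_abs] at h3
      have h4 : |a.toInt + b.toInt - t.toInt| ≤ (b.scaledMag : ℤ) := by exact_mod_cast h3
      have h5 : (((a.toInt + b.toInt - t.toInt).natAbs : ℕ) : ℤ) ≤ (b.scaledMag : ℤ) := by
        rw [Int.natCast_natAbs]; exact h4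
      exact_mod_cast h5
    obtain ⟨e, he⟩ := exists_toRat_eq_intCast_mul _ hrep
    exact ⟨e, by
      rw [he, toRat_eq_toInt_mul t, toRat_eq_toInt_mul a, toRat_eq_toInt_mul b]; push_cast; ring⟩

/-- SAME-SIGN TRUNCATION ERROR IS A VALUE: for values `a, b ≥ 0` of any format,
`a + b - RZ(a + b) ∈ F_φ` (either order, no range hypothesis). [folklore] -/
theorem rz_addErr_representable_of_nonneg (a b : MiniFloat φ) (ha : 0 ≤ a.toRat)
    (hb : 0 ≤ b.toRat) :
    ∃ e : MiniFloat φ, e.toRat = a.toRat + b.toRat - (roundTowardZero φ (a.toRat + b.toRat)).toRat := by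
  rcases le_total b.scaledMag a.scaledMag with h | h
  · exact (rz_add_eft_of_nonneg a b ha hb h).2
  · have := (rz_add_eft_of_nonneg b a hb ha h).2
    rwa [add_comm b.toRat a.toRat] at this

/-- FAST2SUM WITH TRUNCATED OPERATIONS IS EXACT FOR SAME-SIGN OPERANDS: `a, b ≥ 0` values with
`|b| ≤ |a|`, `s = RZ(a + b)`, `z = RZ(s - a)`, `t = RZ(b - z)`: then `z = s - a` and
`t = a + b - s` exactly. [folklore] -/
theorem fast2Sum_rz_exact_of_nonneg (a b : MiniFloat φ) (ha : 0 ≤ a.toRat) (hb : 0 ≤ b.toRat)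
    (hba : |b.toRat| ≤ |a.toRat|) :
    (roundTowardZero φ ((roundTowardZero φ (a.toRat + b.toRat)).toRat - a.toRat)).toRat
        = (roundTowardZero φ (a.toRat + b.toRat)).toRat - a.toRat ∧
    (roundTowardZero φ (b.toRat - (roundTowardZero φ
        ((roundTowardZero φ (a.toRat + b.toRat)).toRat - a.toRat)).toRat)).toRat
        = a.toRat + b.toRat - (roundTowardZero φ (a.toRat + b.toRat)).toRat := by
  obtain ⟨hz, he⟩ := rz_add_eft_of_nonneg a b ha hb (scaledMag_le_of_abs_le hba)
  have h1 := toRat_roundTowardZero_of_exists hz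
  refine ⟨h1, ?_⟩
  rw [h1, show b.toRat - ((roundTowardZero φ (a.toRat + b.toRat)).toRat - a.toRat)
      = a.toRat + b.toRat - (roundTowardZero φ (a.toRat + b.toRat)).toRat by ring]
  exact toRat_roundTowardZero_of_exists he

/-! ### Kernel counterexamples (`E5M2`) -/

/-- MIXED SIGNS: `a = 1`, `b = -2^-9` in `E5M2`: `RZ(a + b) = 7/8`, the error `63/512` is NOT an
`E5M2` value, and Fast2Sum with truncated operations returns `7/64` instead. [folklore] -/
theorem rz_addErr_not_representable_E5M2 :
    let a : MiniFloat E5M2 := ⟨false, 15, 0, by decide, by decide, by decide⟩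
    let b : MiniFloat E5M2 := ⟨true, 6, 0, by decide, by decide, by decide⟩
    a.toRat = 1 ∧ b.toRat = -(1 / 2 ^ 9) ∧
    (roundTowardZero E5M2 (a.toRat + b.toRat)).toRat = 7 / 8 ∧
    a.toRat + b.toRat - (roundTowardZero E5M2 (a.toRat + b.toRat)).toRat = 63 / 512 ∧
    (¬ ∃ e : MiniFloat E5M2, e.toRat = 63 / 512) ∧
    (roundTowardZero E5M2 (b.toRat - (roundTowardZero E5M2
        ((roundTowardZero E5M2 (a.toRat + b.toRat)).toRat - a.toRat)).toRat)).toRat = 7 / 64 := by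
  decide +kernel

/-- Hence the representability statement fails without the sign hypothesis. [folklore] -/
theorem rz_addErr_not_always_representable :
    ¬ ∀ a b : MiniFloat E5M2, ∃ e : MiniFloat E5M2,
      e.toRat = a.toRat + b.toRat - (roundTowardZero E5M2 (a.toRat + b.toRat)).toRat := by
  intro h
  obtain ⟨-, -, -, h4, h5, -⟩ := rz_addErr_not_representable_E5M2
  obtain ⟨e, he⟩ := h ⟨false, 15, 0, by decide, by decide, by decide⟩
    ⟨true, 6, 0, by decide, by decide, by decide⟩
  exact h5 ⟨e, by rw [he, h4]⟩

/-- ROUND-UP, same sign: `a = 1`, `b = 2^-9` in `E5M2`: `RU(a + b) = 5/4`, error `127/512` is not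
an `E5M2` value — only truncation keeps the same-sign EFT. [folklore] -/
theorem ru_addErr_not_representable_E5M2 :
    let a : MiniFloat E5M2 := ⟨false, 15, 0, by decide, by decide, by decide⟩
    let b : MiniFloat E5M2 := ⟨false, 6, 0, by decide, by decide, by decide⟩
    (roundUp E5M2 (a.toRat + b.toRat)).toRat = 5 / 4 ∧
    (roundUp E5M2 (a.toRat + b.toRat)).toRat - (a.toRat + b.toRat) = 127 / 512 ∧
    ¬ ∃ e : MiniFloat E5M2, e.toRat = 127 / 512 := by
  decide +kernel

end MiniFloat

end Literature.ComputerArithmetic.FloatingPoint
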